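import Summits.ValiantsHypothesis.ValiantsHypothesis.Theorems.LangWeilTransferTameResolutionNestedDegree
import Summits.ValiantsHypothesis.ValiantsHypothesis.Theorems.LangWeilTransferTameResolutionNestedWeight
import Summits.ValiantsHypothesis.ValiantsHypothesis.Theorems.LangWeilTransferTameResolutionParamExplicit

/-!
# LangWeilTransfer, support item `TameResolution` (stmt-ValiantsHypothesis-6378) — sizes of the
# equations transported by an integer linear change of coordinates

Route `LangWeilTransfer` of `ValiantsHypothesis` (conditional route; honest framing: bookkeeping,
nothing here bears on VP ≠ VNP). Quantitative pass, the (NQ)→(S) interface (roadmap note of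
val-lit-p6 g9, §4): if `Γ : ℤ[Y] ≃ ℤ[T][X']` sends every variable to a polynomial whose flattening
has total degree `≤ 1` and weight `≤ H`, then for `S_k` of total degree `≤ d` and weight `≤ w` the
transported equation `S'_k = Γ(S_k)` has `X'`-degree `≤ d`, `T`-coefficients of degree `≤ d`, and
nested weight `Σ_β wt(coeff_β S'_k) ≤ w · H^d` — the three hypotheses `hSd`, `hST`, `hSw` of
`exists_parametrisation_explicit` / `EliminantSizes` / `exists_relation_coord`.

* `flat_ringEquiv_eq_aeval` — `flat₁ ∘ Γ = aeval (flat₁ ∘ Γ ∘ X)`;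
* `transport_sizes`.
-/

noncomputable section

open MvPolynomial
open Literature.Computability.AlgebraicComplexity

-- the summit and the problem share the name `ValiantsHypothesis` (D-0017 single-conjunct layout)
set_option linter.dupNamespace false

namespace Summit.ValiantsHypothesis.ValiantsHypothesis.Theorems.LangWeilTransfer

variable {m r n : ℕ}

/-- A ring isomorphism out of `ℤ[Y]`, followed by flattening, is the substitution of the images of
the variables. -/
theorem flat_ringEquiv_eq_aeval (Γ : MvPolynomial (Fin m) ℤ ≃+* MvPolynomial (Fin n) (MvPolynomial (Fin r) ℤ))
    (f : MvPolynomial (Fin m) ℤ) :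
    let flat₁ : MvPolynomial (Fin n) (MvPolynomial (Fin r) ℤ) →+* MvPolynomial (Fin (n + r)) ℤ :=
      (rename finSumFinEquiv : MvPolynomial (Fin n ⊕ Fin r) ℤ →ₐ[ℤ] MvPolynomial (Fin (n + r)) ℤ).toRingHom.comp
        (sumAlgEquiv ℤ (Fin n) (Fin r)).symm.toRingEquiv.toRingHom
    flat₁ (Γ f) = aeval (fun i => flat₁ (Γ (X i))) f := by
  intro flat₁
  have h : flat₁.comp Γ.toRingHom =
      (aeval (fun i => flat₁ (Γ (X i))) : MvPolynomial (Fin m) ℤ →ₐ[ℤ] MvPolynomial (Fin (n + r)) ℤ).toRingHom := by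
    refine MvPolynomial.ringHom_ext (fun z => ?_) (fun i => ?_)
    · simp only [eq_intCast, map_intCast]
    · simp only [RingHom.comp_apply, RingEquiv.toRingHom_eq_coe, RingHom.coe_coe, AlgHom.toRingHom_eq_coe, aeval_X]
  exact congrArg (fun φ => φ f) h

/-- **Sizes of the transported equations.** -/
theorem transport_sizes (Γ : MvPolynomial (Fin m) ℤ ≃+* MvPolynomial (Fin n) (MvPolynomial (Fin r) ℤ))
    {H d w : ℕ} (hH : 1 ≤ H)
    (hΓdeg : ∀ i, (rename finSumFinEquiv ((sumAlgEquiv ℤ (Fin n) (Fin r)).symm (Γ (X i)))).totalDegree ≤ 1)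
    (hΓwt : ∀ i, weight (rename finSumFinEquiv ((sumAlgEquiv ℤ (Fin n) (Fin r)).symm (Γ (X i)))) ≤ H)
    (S : MvPolynomial (Fin m) ℤ) (hSd : S.totalDegree ≤ d) (hSw : weight S ≤ w) :
    (Γ S).totalDegree ≤ d ∧ (∀ β, ((Γ S).coeff β).totalDegree ≤ d) ∧
      ((Γ S).support.sum fun β => weight ((Γ S).coeff β)) ≤ w * H ^ d := by
  -- the flattening of `Γ S` is `aeval g S`
  have hflat := flat_ringEquiv_eq_aeval Γ S
  simp only at hflat
  change rename finSumFinEquiv ((sumAlgEquiv ℤ (Fin n) (Fin r)).symm (Γ S)) = aeval _ S at hflat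
  set F := rename finSumFinEquiv ((sumAlgEquiv ℤ (Fin n) (Fin r)).symm (Γ S)) with hF
  have hFdeg : F.totalDegree ≤ d := by
    rw [hflat]
    exact (totalDegree_aeval_le_mul _ (e := 1) hΓdeg S).trans (by rw [one_mul]; exact hSd)
  have hFwt : weight F ≤ w * H ^ d := by
    rw [hflat]
    refine (weight_aeval_le_mul_pow _ hH hΓwt S).trans ?_
    exact Nat.mul_le_mul hSw (Nat.pow_le_pow_right hH hSd)
  -- un-rename: sizes of `(sumAlgEquiv).symm (Γ S)`
  set F₀' := (sumAlgEquiv ℤ (Fin n) (Fin r)).symm (Γ S) with hF₀'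
  have hF₀deg : F₀'.totalDegree ≤ d := by
    have h2 := totalDegree_rename_le (finSumFinEquiv (m := n) (n := r)).symm F
    rw [hF, rename_rename, Equiv.symm_comp_self, rename_id] at h2
    exact h2.trans hFdeg
  have hF₀wt : weight F₀' = weight F := by
    rw [hF, weight_rename_of_injective (Equiv.injective _)]
  have hΓS : Γ S = sumAlgEquiv ℤ (Fin n) (Fin r) F₀' := by rw [hF₀', AlgEquiv.apply_symm_apply]
  refine ⟨?_, fun β => ?_, ?_⟩
  · rw [hΓS]; exact (totalDegree_sumAlgEquiv_le _).trans hF₀deg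
  · exact (totalDegree_coeff_le_totalDegree_flat (Γ S) β).trans hF₀deg
  · refine (sum_weight_coeff_le_weight_flat (Γ S)).trans ?_
    rw [← hF₀', hF₀wt]; exact hFwt

end Summit.ValiantsHypothesis.ValiantsHypothesis.Theorems.LangWeilTransfer
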